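import Literature.MathematicalPhysics.QuantumFieldTheory.TomboulisYaffeInequality
import Literature.MathematicalPhysics.QuantumFieldTheory.WilsonPlaquettePositivity
import Literature.MathematicalPhysics.QuantumFieldTheory.VortexTwistCohomology
import Literature.MathematicalPhysics.QuantumLattice.TwistedBoundaryConditions
import Mathlib.RingTheory.RootsOfUnity.Complex
import HarnessLib

/-!
# The vortex (electric-flux) free energy of a finite torus is STRICTLY positive at every `β ≠ 0`:
# `Z_{β,L}(z; q) < Z_{β,L}(1; q)` — the strict clause of Tomboulis's Prop. IV.1

E. T. Tomboulis, *Confinement for all values of the coupling in four-dimensional SU(2) gauge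
theory*, arXiv:0707.2179 (2007), Prop. IV.1, eq. (4.6): with `c_j ≥ 0`,
`Z⁻_Λ({c_j}) ≤ Z_Λ({c_j})`, followed by the sentence "Strict inequality holds in fact in (4.6) for
any nonvanishing `β` on any finite lattice."  Appendix A §5 of that paper proves only the weak
inequality ("every term … is manifestly non-negative by RP"); no argument for the strict clause is
printed there or in the replies.  The tree has the weak inequality for Wilson's action with an
arbitrary compact gauge group (`twistedPartitionFunction_le_untwisted`, Kanazawa 2009 eq. (17),
file `TwistedPartitionFunctionRPBound`): `Z(z; q)/Z(1; q) ∈ (0, 1]`.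

This file PROVES the strict clause for Wilson's action on the torus `(ℤ/Lℤ)^d` of side
`L = 2^(n+1)`, for every compact group `G`, every continuous `N`-dimensional representation `ρ`
(`N ≥ 1`) with a central element `z` acting by a scalar `ω ≠ 1`, `|ω| = 1` (the centre of `SU(N)` in
the fundamental representation; `ω = -1` for `SU(2)`), every dimension `d ≥ 2`, every plane,
and EVERY `β ≠ 0`:

* `twistedPartitionFunction_lt_untwisted` — `Z_{β,L}(z; (0,j)) < Z_{β,L}(1; (0,j))`; every plane `q`:
  `twistedPartitionFunction_lt_untwisted_plane` (relabelling of the axes,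
  `twistedPartitionFunction_eq_transpose_zero`), with `_ratio_lt_one_plane`, `vortexFreeEnergy_pos_plane`,
  `su2_twistedPartitionFunction_lt_untwisted_plane`; `SU(N)`, every non-trivial centre element `ω^k 𝟙`:
  `suN_twistedPartitionFunction_lt_untwisted_plane`, `suN_vortexFreeEnergy_pos_plane`;
* `twistedPartitionFunction_ratio_lt_one`, `vortexFreeEnergy_pos` — `Z(z)/Z(1) < 1`, i.e.
  `0 < F_v = -log (Z(z)/Z(1))`; for `ρ(z) = -1` the electric-flux free energy
  `exp(-F_el) = ½(1 - Z⁻/Z)` of 't Hooft / Tomboulis–Yaffe (2.9) is `> 0` (`electricFlux_pos`).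

The route is NOT a strictness statement about the reflection-positivity Gram form.  It combines
two things: (i) the Tomboulis–Yaffe chain already in the tree
(`TomboulisYaffe.plaquette_abs_le_twist`, CMP 100 (1985) App. I (A1.3)–(A1.9)):
`|⟨W_{1×1}⟩_β| ≤ N^{2/L} · (8(1 - Z(z)/Z(1))/|1 - ω|²)^{1/L²}`, so `Z(z) = Z(1)` forces the plaquette
expectation to vanish; (ii) **the plaquette expectation does not vanish at `β ≠ 0`**
(`wilsonExpectation_wilsonLoop_one_one_pos` / `_neg` of `WilsonPlaquettePositivity`: the mean
Wilson action is STRICTLY decreasing in `β` (`WilsonEnergyStrictMonotone`), `⟨S⟩_0 = N · #plaquettes`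
because the Haar mean of `tr ρ(U_p)` vanishes, and all plaquettes have the same mean).

NOT claimed here: the strict inequality for Tomboulis's truncated character actions `torusZtw`
(`TomboulisVortexDecimation`; that needs transfer-operator positivity, not in the tree — `Z⁻ > 0` for
those is `Summit.Ventures.YMGap.Census.torusZtw_vortexSheet_pos`), side lengths that are not powers of two
(the Tomboulis–Yaffe chain of the tree is stated for `L = 2^(n+1)`), anything about the thermodynamic limit.
-- TODO(general form): every even `L` (reflection positivity gives `Z(z) ≤ Z(1)` there, but the
-- Tomboulis–Yaffe chain of the tree halves loops down to the plaquette, whence `L = 2^(n+1)`).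

## References

* E. T. Tomboulis, arXiv:0707.2179 (2007), §4 Prop. IV.1, eq. (4.6) and the sentence after it;
  App. A §5. [Tomboulis2007Confinement]
* E. T. Tomboulis, L. G. Yaffe, Comm. Math. Phys. 100 (1985) 313–341, §II (2.9)–(2.10), App. I
  (A1.3)–(A1.9). [TomboulisYaffe1985]
* T. Kanazawa, Ann. Phys. 324 (2009) 1634, §2 Lemma 2 eq. (17) (`0 ≤ Z^g/Z ≤ 1`). [Kanazawa2008]
* S. Friedli, Y. Velenik, *Statistical Mechanics of Lattice Systems*, CUP 2017, Lemma 3.5 (p. 94)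
  and App. B.8.1 (convexity of the pressure; the energy is its derivative). [FriedliVelenik2017]
* I. Montvay, G. Münster, *Quantum Fields on a Lattice*, CUP 1994, §3.2 (3.113) (internal energy =
  mean plaquette). [MontvayMunster1994]
-/

noncomputable section

open MeasureTheory

namespace Literature.MathematicalPhysics.QuantumFieldTheory

variable {d L N : ℕ} {G : Type*} [Group G] [TopologicalSpace G] [IsTopologicalGroup G]
  [CompactSpace G] [MeasurableSpace G] [BorelSpace G] (ρ : G →* Matrix (Fin N) (Fin N) ℂ)

/-! ### The strict inequality `Z(z) < Z(1)` -/

section Strict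

variable [NeZero d] [NeZero L]

/-- **Tomboulis's Prop. IV.1, strict clause, for Wilson's action** ("Strict inequality holds in fact
in (4.6) for any nonvanishing `β` on any finite lattice"): on the torus `(ℤ/Lℤ)^d` of side
`L = 2^(n+1)`, for a compact group `G`, a continuous `N`-dimensional representation `ρ` (`N ≥ 1`)
with a central `z` acting by the scalar `ω`, `|ω| = 1`, `ω ≠ 1`, a spatial direction `j`, and EVERY
`β ≠ 0`: `Z_{β,L}(z; (0,j)) < Z_{β,L}(1; (0,j))` — the twist ('t Hooft flux, Tomboulis's `𝒱`)
strictly lowers the partition function.  Proof: if `Z(z) = Z(1)` the Tomboulis–Yaffe bound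
`|⟨W_{1×1}⟩| ≤ N^{2/L} (8(1 - Z(z)/Z(1))/|1 - ω|²)^{1/L²}` forces `⟨W_{1×1}⟩ = 0`, contradicting
`wilsonExpectation_wilsonLoop_one_one_pos/neg`.
[cite: Tomboulis2007Confinement, §4 Prop. IV.1 eq. (4.6) and the sentence following it]
[cite: TomboulisYaffe1985, App. I eqs. (A1.8)–(A1.9)] -/
theorem twistedPartitionFunction_lt_untwisted [NeZero N] (n : ℕ) (hL : L = 2 ^ (n + 1))
    (hρ : Continuous ρ) {β : ℝ} (hβ : β ≠ 0) {j : Fin d} (hj : (0 : Fin d) < j) {z : G}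
    (hz : z ∈ Subgroup.center G) {ω : ℂ} (hω : ρ z = ω • (1 : Matrix (Fin N) (Fin N) ℂ))
    (hω1 : ‖ω‖ = 1) (hne : ω ≠ 1) :
    twistedPartitionFunction ρ β L z ⟨(0, j), hj⟩ < twistedPartitionFunction ρ β L 1 ⟨(0, j), hj⟩ := by
  have hLe : Even L := ⟨2 ^ n, by rw [hL, pow_succ]; ring⟩
  haveI : Fact (1 < L) := ⟨by rw [hL]; exact Nat.one_lt_two_pow (Nat.succ_ne_zero n)⟩
  have hj0 : (0 : Fin d) ≠ j := ne_of_lt hj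
  have hW : wilsonExpectation ρ β (wilsonLoop ρ (0 : Site d L) 0 j 1 1) ≠ 0 := by
    rcases lt_or_gt_of_ne hβ with hneg | hpos
    · exact (wilsonExpectation_wilsonLoop_one_one_neg ρ hρ hω hω1 hne hneg 0 hj0).ne
    · exact (wilsonExpectation_wilsonLoop_one_one_pos ρ hρ hω hω1 hne hpos 0 hj0).ne'
  have hle := twistedPartitionFunction_le_untwisted ρ β hLe hρ hz j hj
  refine lt_of_le_of_ne hle fun heq => hW ?_
  have h := TomboulisYaffe.plaquette_abs_le_twist ρ n hL hρ β hj hz hω hω1 hne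
  have h1 : 0 < twistedPartitionFunction ρ β L 1 ⟨(0, j), hj⟩ :=
    twistedPartitionFunction_pos ρ hρ β 1 _
  have hL0 : (1 : ℝ) / (L : ℝ) ^ 2 ≠ 0 :=
    div_ne_zero one_ne_zero (pow_ne_zero 2 (Nat.cast_ne_zero.2 (NeZero.ne L)))
  rw [heq, div_self h1.ne', sub_self, mul_zero, zero_div, Real.zero_rpow hL0, mul_zero] at h
  exact abs_nonpos_iff.1 h

/-- **The vortex free-energy ratio is `< 1`**: `Z_{β,L}(z; (0,j)) / Z_{β,L}(1; (0,j)) < 1` (with the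
tree's `twistedPartitionFunction_ratio_mem_Ioc` the ratio lies in `(0, 1)`).
[cite: Tomboulis2007Confinement, §4 Prop. IV.1 eq. (4.6) and the sentence following it] -/
theorem twistedPartitionFunction_ratio_lt_one [NeZero N] (n : ℕ) (hL : L = 2 ^ (n + 1))
    (hρ : Continuous ρ) {β : ℝ} (hβ : β ≠ 0) {j : Fin d} (hj : (0 : Fin d) < j) {z : G}
    (hz : z ∈ Subgroup.center G) {ω : ℂ} (hω : ρ z = ω • (1 : Matrix (Fin N) (Fin N) ℂ))
    (hω1 : ‖ω‖ = 1) (hne : ω ≠ 1) :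
    twistedPartitionFunction ρ β L z ⟨(0, j), hj⟩ / twistedPartitionFunction ρ β L 1 ⟨(0, j), hj⟩ < 1 :=
  (div_lt_one (twistedPartitionFunction_pos ρ hρ β 1 _)).2
    (twistedPartitionFunction_lt_untwisted ρ n hL hρ hβ hj hz hω hω1 hne)

/-- **The vortex free energy is strictly positive**: `0 < F_v = -log (Z(z; (0,j))/Z(1; (0,j)))` at
every `β ≠ 0` (Tomboulis (6.1): `exp(-F⁻_Λ) = Z⁻_Λ/Z_Λ`; Kanazawa 2009 eq. (17) has the weak form
`F_v ≥ 0`). [cite: Tomboulis2007Confinement, §4 Prop. IV.1 eq. (4.6) and §6 eq. (6.1)]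
[cite: Kanazawa2008, §2 Lemma 2 eq. (17)] -/
theorem vortexFreeEnergy_pos [NeZero N] (n : ℕ) (hL : L = 2 ^ (n + 1))
    (hρ : Continuous ρ) {β : ℝ} (hβ : β ≠ 0) {j : Fin d} (hj : (0 : Fin d) < j) {z : G}
    (hz : z ∈ Subgroup.center G) {ω : ℂ} (hω : ρ z = ω • (1 : Matrix (Fin N) (Fin N) ℂ))
    (hω1 : ‖ω‖ = 1) (hne : ω ≠ 1) :
    0 < -Real.log (twistedPartitionFunction ρ β L z ⟨(0, j), hj⟩ /
      twistedPartitionFunction ρ β L 1 ⟨(0, j), hj⟩) := by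
  rw [neg_pos]
  exact Real.log_neg (div_pos (twistedPartitionFunction_pos ρ hρ β z _)
    (twistedPartitionFunction_pos ρ hρ β 1 _))
    (twistedPartitionFunction_ratio_lt_one ρ n hL hρ hβ hj hz hω hω1 hne)

/-- **'t Hooft's electric-flux Boltzmann factor is strictly positive** for an `SU(2)`-type centre
element (`ρ(z) = -1`, so `Z(z) = Z⁻`): `0 < ½(1 - Z⁻/Z) < ½` at every `β ≠ 0` on the torus of side
`2^(n+1)` — Tomboulis–Yaffe (2.9) `exp(-F_el/T) = ½(1 - Z⁻/Z)` is a genuine (finite) free energy,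
and Tomboulis's (5.3) `1 < 1 + Z⁻/Z < 2` holds with STRICT right inequality.
[cite: TomboulisYaffe1985, §II eq. (2.9)] [cite: Tomboulis2007Confinement, §5 eq. (5.3)] -/
theorem electricFlux_pos [NeZero N] (n : ℕ) (hL : L = 2 ^ (n + 1)) (hρ : Continuous ρ)
    {β : ℝ} (hβ : β ≠ 0) {j : Fin d} (hj : (0 : Fin d) < j) {z : G} (hz : z ∈ Subgroup.center G)
    (hω : ρ z = -(1 : Matrix (Fin N) (Fin N) ℂ)) :
    0 < (1 - twistedPartitionFunction ρ β L z ⟨(0, j), hj⟩ /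
        twistedPartitionFunction ρ β L 1 ⟨(0, j), hj⟩) / 2 ∧
      (1 - twistedPartitionFunction ρ β L z ⟨(0, j), hj⟩ /
        twistedPartitionFunction ρ β L 1 ⟨(0, j), hj⟩) / 2 < 1 / 2 := by
  have hω' : ρ z = (-1 : ℂ) • (1 : Matrix (Fin N) (Fin N) ℂ) := by rw [hω, neg_smul, one_smul]
  have hlt := twistedPartitionFunction_ratio_lt_one ρ n hL hρ hβ hj hz hω' (by simp) (by norm_num)
  have hpos : 0 < twistedPartitionFunction ρ β L z ⟨(0, j), hj⟩ /
      twistedPartitionFunction ρ β L 1 ⟨(0, j), hj⟩ :=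
    div_pos (twistedPartitionFunction_pos ρ hρ β z _) (twistedPartitionFunction_pos ρ hρ β 1 _)
  constructor <;> linarith

/-- **Tomboulis's (5.3), both inequalities STRICT, for Wilson's action**: `1 < 1 + Z(z)/Z(1) < 2` at
every `β ≠ 0` on the torus of side `2^(n+1)` (left: the twisted Wilson weight is positive,
`twistedPartitionFunction_pos`; right: `twistedPartitionFunction_ratio_lt_one`).  Printed: "(5.3)
`1 < 1 + Z⁻_Λ/Z_Λ < 2` … by IV.1". [cite: Tomboulis2007Confinement, §5 eq. (5.3)] -/
theorem one_lt_one_add_twistRatio_and_lt_two [NeZero N] (n : ℕ) (hL : L = 2 ^ (n + 1))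
    (hρ : Continuous ρ) {β : ℝ} (hβ : β ≠ 0) {j : Fin d} (hj : (0 : Fin d) < j) {z : G}
    (hz : z ∈ Subgroup.center G) {ω : ℂ} (hω : ρ z = ω • (1 : Matrix (Fin N) (Fin N) ℂ))
    (hω1 : ‖ω‖ = 1) (hne : ω ≠ 1) :
    1 < 1 + twistedPartitionFunction ρ β L z ⟨(0, j), hj⟩ / twistedPartitionFunction ρ β L 1 ⟨(0, j), hj⟩ ∧
      1 + twistedPartitionFunction ρ β L z ⟨(0, j), hj⟩ /
        twistedPartitionFunction ρ β L 1 ⟨(0, j), hj⟩ < 2 := by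
  have hpos : 0 < twistedPartitionFunction ρ β L z ⟨(0, j), hj⟩ /
      twistedPartitionFunction ρ β L 1 ⟨(0, j), hj⟩ :=
    div_pos (twistedPartitionFunction_pos ρ hρ β z _) (twistedPartitionFunction_pos ρ hρ β 1 _)
  have hlt := twistedPartitionFunction_ratio_lt_one ρ n hL hρ hβ hj hz hω hω1 hne
  constructor <;> linarith

/-- **The Tomboulis–Yaffe confinement criterion in free-energy form, hypothesis-free at `β > 0`**
(`SU(2)`-type centre, `ρ(z) = -1`): on the torus of side `L = 2^(n+1)`,
`-ln(½(1 - Z⁻/Z)) ≤ L² (-ln⟨W_{1×1}⟩_β) + 2L ln N + ln 4` for every `β > 0` — the tree's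
`TomboulisYaffe.neg_log_electricFlux_le_plaquette` with its positivity hypothesis `0 < ⟨W_{1×1}⟩_β`
discharged by `wilsonExpectation_wilsonLoop_one_one_pos`. [cite: TomboulisYaffe1985, §II eqs. (2.9)–(2.10), App. I] -/
theorem neg_log_electricFlux_le_plaquette_of_pos [NeZero N] (n : ℕ) (hL : L = 2 ^ (n + 1))
    (hρ : Continuous ρ) {β : ℝ} (hβ : 0 < β) {j : Fin d} (hj : (0 : Fin d) < j) {z : G}
    (hz : z ∈ Subgroup.center G) (hω : ρ z = -(1 : Matrix (Fin N) (Fin N) ℂ)) :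
    -Real.log ((1 - twistedPartitionFunction ρ β L z ⟨(0, j), hj⟩ /
        twistedPartitionFunction ρ β L 1 ⟨(0, j), hj⟩) / 2) ≤
      (L : ℝ) ^ 2 * (-Real.log (wilsonExpectation ρ β (wilsonLoop ρ (0 : Site d L) 0 j 1 1))) +
        2 * L * Real.log N + Real.log 4 := by
  haveI : Fact (1 < L) := ⟨by rw [hL]; exact Nat.one_lt_two_pow (Nat.succ_ne_zero n)⟩
  have hω' : ρ z = (-1 : ℂ) • (1 : Matrix (Fin N) (Fin N) ℂ) := by rw [hω, neg_smul, one_smul]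
  exact TomboulisYaffe.neg_log_electricFlux_le_plaquette ρ n hL hρ β hj hz hω
    (wilsonExpectation_wilsonLoop_one_one_pos ρ hρ hω' (by simp) (by norm_num) hβ 0 (ne_of_lt hj))

/-- **`SU(2)` with its fundamental representation and the twist `-𝟙`** (Tomboulis's setting: "In the
case of SU(2) … there is only one nontrivial element, `τ_{μν} = -1`"; the tree's `Tomboulis2007.negOne`):
on `(ℤ/Lℤ)^d`, `L = 2^(n+1)`, for every `β ≠ 0` and every spatial direction `j`,
`Z⁻_{β,L} = Z_{β,L}(-𝟙; (0,j)) < Z_{β,L}(𝟙; (0,j)) = Z_{β,L}`.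
[cite: Tomboulis2007Confinement, §4 Prop. IV.1 eq. (4.6) and the sentence following it] -/
theorem su2_twistedPartitionFunction_lt_untwisted (n : ℕ) (hL : L = 2 ^ (n + 1)) {β : ℝ}
    (hβ : β ≠ 0) {j : Fin d} (hj : (0 : Fin d) < j) :
    twistedPartitionFunction (Literature.MathematicalPhysics.QuantumLattice.fundamentalRep (Fin 2)) β L
        Tomboulis2007.negOne ⟨(0, j), hj⟩ <
      twistedPartitionFunction (Literature.MathematicalPhysics.QuantumLattice.fundamentalRep (Fin 2)) β L
        1 ⟨(0, j), hj⟩ := by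
  have hz : Tomboulis2007.negOne ∈ Subgroup.center Tomboulis2007.SU2 :=
    Subgroup.mem_center_iff.2 fun g => (Tomboulis2007.negOne_mul_comm g).symm
  have hω : Literature.MathematicalPhysics.QuantumLattice.fundamentalRep (Fin 2) Tomboulis2007.negOne =
      (-1 : ℂ) • (1 : Matrix (Fin 2) (Fin 2) ℂ) := by
    rw [neg_smul, one_smul]
    rfl
  exact twistedPartitionFunction_lt_untwisted _ n hL
    (Literature.MathematicalPhysics.QuantumLattice.continuous_fundamentalRep (Fin 2)) hβ hj hz hω
    (by simp) (by norm_num)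

/-! ### Every plane

For a plane `q = (μ, ν)` with `0 < μ` the relabelling `0 ↔ μ` of the axes
(`twistedPartitionFunction_eq_transpose_zero`, a measure-preserving change of the link variables) carries
`Z(z; (μ, ν))` to `Z(z; (0, ν))`, so the strict inequality holds in every plane — as printed: «on any finite
lattice», no plane singled out. -/

/-- **Tomboulis's Proposition IV.1, the strict inequality, in EVERY plane** `q = (μ, ν)`, `μ < ν`, of the torus
`(ℤ/Lℤ)^d`, `L = 2^(n+1)`: `Z_{β,L}(z; q) < Z_{β,L}(1; q)` for every `β ≠ 0` and every central `z` acting in `ρ`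
by a scalar `ω ≠ 1`. [cite: Tomboulis2007Confinement, §4 Prop. IV.1 eq. (4.6) and the sentence following it]
[cite: Kanazawa2008, §2 Lemma 2 eq. (17)] -/
theorem twistedPartitionFunction_lt_untwisted_plane [NeZero N] (n : ℕ) (hL : L = 2 ^ (n + 1))
    (hρ : Continuous ρ) {β : ℝ} (hβ : β ≠ 0) (q : {p : Fin d × Fin d // p.1 < p.2}) {z : G}
    (hz : z ∈ Subgroup.center G) {ω : ℂ} (hω : ρ z = ω • (1 : Matrix (Fin N) (Fin N) ℂ))
    (hω1 : ‖ω‖ = 1) (hne : ω ≠ 1) :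
    twistedPartitionFunction ρ β L z q < twistedPartitionFunction ρ β L 1 q := by
  obtain ⟨⟨μ, ν⟩, hμν⟩ := q
  by_cases hμ : μ = 0
  · subst hμ
    exact twistedPartitionFunction_lt_untwisted ρ n hL hρ hβ hμν hz hω hω1 hne
  · have hμ' : (0 : Fin d) < μ := by
      rw [Fin.lt_def, Fin.val_zero]
      exact Nat.pos_of_ne_zero fun h => hμ (Fin.ext (by rw [h, Fin.val_zero]))
    rw [twistedPartitionFunction_eq_transpose_zero ρ β hρ z hμ' hμν,
      twistedPartitionFunction_eq_transpose_zero ρ β hρ 1 hμ' hμν]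
    exact twistedPartitionFunction_lt_untwisted ρ n hL hρ hβ (hμ'.trans hμν) hz hω hω1 hne

/-- **`Z(z; q)/Z(1; q) < 1` in every plane** (so, with `twistedPartitionFunction_ratio_mem_Ioc`, the ratio lies
in `(0, 1)`). [cite: Tomboulis2007Confinement, §4 Prop. IV.1 eq. (4.6) and the sentence following it] -/
theorem twistedPartitionFunction_ratio_lt_one_plane [NeZero N] (n : ℕ) (hL : L = 2 ^ (n + 1))
    (hρ : Continuous ρ) {β : ℝ} (hβ : β ≠ 0) (q : {p : Fin d × Fin d // p.1 < p.2}) {z : G}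
    (hz : z ∈ Subgroup.center G) {ω : ℂ} (hω : ρ z = ω • (1 : Matrix (Fin N) (Fin N) ℂ))
    (hω1 : ‖ω‖ = 1) (hne : ω ≠ 1) :
    twistedPartitionFunction ρ β L z q / twistedPartitionFunction ρ β L 1 q < 1 :=
  (div_lt_one (twistedPartitionFunction_pos ρ hρ β 1 _)).2
    (twistedPartitionFunction_lt_untwisted_plane ρ n hL hρ hβ q hz hω hω1 hne)

/-- **The vortex free energy is strictly positive in every plane**: `0 < -log (Z(z; q)/Z(1; q))` at every
`β ≠ 0`. [cite: Tomboulis2007Confinement, §4 Prop. IV.1 eq. (4.6) and §6 eq. (6.1)]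
[cite: Kanazawa2008, §2 Lemma 2 eq. (17)] -/
theorem vortexFreeEnergy_pos_plane [NeZero N] (n : ℕ) (hL : L = 2 ^ (n + 1))
    (hρ : Continuous ρ) {β : ℝ} (hβ : β ≠ 0) (q : {p : Fin d × Fin d // p.1 < p.2}) {z : G}
    (hz : z ∈ Subgroup.center G) {ω : ℂ} (hω : ρ z = ω • (1 : Matrix (Fin N) (Fin N) ℂ))
    (hω1 : ‖ω‖ = 1) (hne : ω ≠ 1) :
    0 < -Real.log (twistedPartitionFunction ρ β L z q / twistedPartitionFunction ρ β L 1 q) := by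
  rw [neg_pos]
  exact Real.log_neg (div_pos (twistedPartitionFunction_pos ρ hρ β z _)
    (twistedPartitionFunction_pos ρ hρ β 1 _))
    (twistedPartitionFunction_ratio_lt_one_plane ρ n hL hρ hβ q hz hω hω1 hne)

/-- **`SU(2)`, fundamental representation, twist `-𝟙`, every plane**: `Z⁻_{β,L}(q) < Z_{β,L}(q)` on
`(ℤ/Lℤ)^d`, `L = 2^(n+1)`, for every `β ≠ 0` and every plane `q`.
[cite: Tomboulis2007Confinement, §4 Prop. IV.1 eq. (4.6) and the sentence following it] -/
theorem su2_twistedPartitionFunction_lt_untwisted_plane (n : ℕ) (hL : L = 2 ^ (n + 1)) {β : ℝ}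
    (hβ : β ≠ 0) (q : {p : Fin d × Fin d // p.1 < p.2}) :
    twistedPartitionFunction (Literature.MathematicalPhysics.QuantumLattice.fundamentalRep (Fin 2)) β L
        Tomboulis2007.negOne q <
      twistedPartitionFunction (Literature.MathematicalPhysics.QuantumLattice.fundamentalRep (Fin 2)) β L
        1 q := by
  have hz : Tomboulis2007.negOne ∈ Subgroup.center Tomboulis2007.SU2 :=
    Subgroup.mem_center_iff.2 fun g => (Tomboulis2007.negOne_mul_comm g).symm
  have hω : Literature.MathematicalPhysics.QuantumLattice.fundamentalRep (Fin 2) Tomboulis2007.negOne =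
      (-1 : ℂ) • (1 : Matrix (Fin 2) (Fin 2) ℂ) := by
    rw [neg_smul, one_smul]
    rfl
  exact twistedPartitionFunction_lt_untwisted_plane _ n hL
    (Literature.MathematicalPhysics.QuantumLattice.continuous_fundamentalRep (Fin 2)) hβ q hz hω
    (by simp) (by norm_num)

/-! ### `SU(N)`: every non-trivial centre element

In the fundamental representation of `SU(N)` the centre element `ω^k · 𝟙`, `ω = e^{2πi/N}`
(`QuantumLattice.suCenter N k`), acts by the scalar `ω^k`, which is `≠ 1` exactly for `k ≠ 0` in `ℤ/N`
(primitivity of `ω`).  So, for every `N`, every non-trivial 't Hooft twist strictly lowers the partition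
function at every `β ≠ 0` — Tomboulis's setting for general `SU(N)` (§2: "straightforward generalization";
Kanazawa's Lemma 2 with `H = Z_N`). -/

/-- The centre phase `ω^k = e^{2πik/N}` is `≠ 1` for `k ≠ 0` in `ℤ/N` (`ω` is a primitive `N`-th root of
unity). [folklore] -/
private theorem centerPhase_ne_one [NeZero N] {k : ZMod N} (hk : k ≠ 0) :
    Literature.MathematicalPhysics.QuantumLattice.centerPhase N k ≠ 1 := by
  have hprim := Complex.isPrimitiveRoot_exp N (NeZero.ne N)
  have hpow : Literature.MathematicalPhysics.QuantumLattice.centerPhase N k =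
      Complex.exp (2 * Real.pi * Complex.I / N) ^ k.val := by
    rw [← Complex.exp_nat_mul, Literature.MathematicalPhysics.QuantumLattice.centerPhase]
    congr 1
    push_cast
    ring
  rw [hpow, Ne, hprim.pow_eq_one_iff_dvd]
  exact fun hdvd => hk ((ZMod.val_eq_zero k).1 (Nat.eq_zero_of_dvd_of_lt hdvd (ZMod.val_lt k)))

/-- **`SU(N)`, fundamental representation, every non-trivial centre twist, every plane**: on `(ℤ/Lℤ)^d`,
`L = 2^(n+1)`, for every `N ≥ 1`, every `k ≠ 0` in `ℤ/N`, every `β ≠ 0` and every plane `q`,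
`Z_{β,L}(ω^k 𝟙; q) < Z_{β,L}(𝟙; q)` — the electric-flux free energy of every non-trivial `Z_N` flux is
strictly positive on every finite torus of this shape.
[cite: Tomboulis2007Confinement, §4 Prop. IV.1 eq. (4.6) and the sentence following it]
[cite: Kanazawa2008, §2 Lemma 2 eq. (17)] -/
theorem suN_twistedPartitionFunction_lt_untwisted_plane [NeZero N] (n : ℕ) (hL : L = 2 ^ (n + 1))
    {β : ℝ} (hβ : β ≠ 0) (q : {p : Fin d × Fin d // p.1 < p.2}) {k : ZMod N} (hk : k ≠ 0) :
    twistedPartitionFunction (Literature.MathematicalPhysics.QuantumLattice.fundamentalRep (Fin N)) β L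
        (Literature.MathematicalPhysics.QuantumLattice.suCenter N k : Matrix.specialUnitaryGroup (Fin N) ℂ) q <
      twistedPartitionFunction (Literature.MathematicalPhysics.QuantumLattice.fundamentalRep (Fin N)) β L
        1 q :=
  twistedPartitionFunction_lt_untwisted_plane _ n hL
    (Literature.MathematicalPhysics.QuantumLattice.continuous_fundamentalRep (Fin N)) hβ q
    (Literature.MathematicalPhysics.QuantumLattice.suCenter N k).2
    (Literature.MathematicalPhysics.QuantumLattice.coe_suCenter N k)
    (Literature.MathematicalPhysics.QuantumLattice.norm_centerPhase N k) (centerPhase_ne_one hk)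

/-- **The `Z_N` vortex free energy is strictly positive**: `0 < -log (Z(ω^k 𝟙; q)/Z(𝟙; q))` for every
`k ≠ 0`, `β ≠ 0`, plane `q`, on the torus of side `2^(n+1)`.
[cite: Tomboulis2007Confinement, §4 Prop. IV.1 eq. (4.6) and §6 eq. (6.1)] [cite: Kanazawa2008, §2 Lemma 2 eq. (17)] -/
theorem suN_vortexFreeEnergy_pos_plane [NeZero N] (n : ℕ) (hL : L = 2 ^ (n + 1)) {β : ℝ} (hβ : β ≠ 0)
    (q : {p : Fin d × Fin d // p.1 < p.2}) {k : ZMod N} (hk : k ≠ 0) :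
    0 < -Real.log
      (twistedPartitionFunction (Literature.MathematicalPhysics.QuantumLattice.fundamentalRep (Fin N)) β L
          (Literature.MathematicalPhysics.QuantumLattice.suCenter N k : Matrix.specialUnitaryGroup (Fin N) ℂ) q /
        twistedPartitionFunction (Literature.MathematicalPhysics.QuantumLattice.fundamentalRep (Fin N)) β L
          1 q) :=
  vortexFreeEnergy_pos_plane _ n hL
    (Literature.MathematicalPhysics.QuantumLattice.continuous_fundamentalRep (Fin N)) hβ q
    (Literature.MathematicalPhysics.QuantumLattice.suCenter N k).2
    (Literature.MathematicalPhysics.QuantumLattice.coe_suCenter N k)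
    (Literature.MathematicalPhysics.QuantumLattice.norm_centerPhase N k) (centerPhase_ne_one hk)

end Strict

end Literature.MathematicalPhysics.QuantumFieldTheory

end
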